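import Literature.Combinatorics.Additive.CouplingBiglobal
import Literature.Combinatorics.Additive.ProductSpaceHypercontractivity
import HarnessLib

/-!
# The level-`d` inequality for biglobal functions on `S_n` from the product-space inequality (Keevash–Lifshitz 2023, Thm 3.1 ⇒ Thm 1.8)

Source: P. Keevash, N. Lifshitz, *Sharp hypercontractivity for symmetric groups and its applications*,
arXiv:2307.15030 [KeevashLifshitz2023], §2.3 ("An alternative proof of Theorem 1.4": the operator
`T = R_τ* S* S R_τ`, its eigenvalues on `V_{=d}`, the junta test functions) and §3, Lemma 3.6 / Theorem 3.1
(the level-`d` inequality transferred from the product space); held text `paper:arxiv-2307.15030` pp. 13–18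
read first-hand (cell pnp-psdrank, lit g20, 2026-08-27). The product-space input is
N. Keller, N. Lifshitz, O. Marcus, *Sharp hypercontractivity for global functions*, arXiv:2307.01356
[KellerLifshitzMarcus2023], Thm 5.4, vendored as the named fact `ProductSpace.KellerLifshitzMarcus2023_thm54`.

Last brick of the programme (cell memo LIT-26, Milestone M): **`GlobalLevelDInequalityBiglobal_of_klm`**
derives the tree's named fact `GlobalLevelDInequalityBiglobal` (KL Thm 3.1 for `S_n`, constant `10⁶`)
— and hence `GlobalLevelDInequality` (KL Thm 1.8, via the tree's `GlobalLevelDInequality_of_biglobal`) —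
from the single hypothesis `KellerLifshitzMarcus2023_thm54` (a theorem of a refereed JEMS paper), with
everything on the `S_n` side PROVED: the coupling (bricks `ForgetfulCoupling`, `CouplingBiglobal`), the
Kneser-graph/junta lower bound (bricks `TupleKneserBound`, `SpreadCouplingTuples`), and here the operator
argument. Honest accounting: this is a RE-BASING of the r = 1 rung's hypothesis onto KLM Thm 5.4 (net
debt of the programme +1 − 0), not a discharge `GlobalLevelDInequalityBiglobal_holds`.

## The argument (KL §2.3 made quantitative, counting normalisation)

* `Rop τ f (σ) = f(στ)` (right translation, an isometry of `SnSpace n` preserving every `V_{≤d'}` and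
  commuting with the projections `projLE`), `Aop f (x) = Σ_σ C(σ,x) f(σ)` (`S_n → [n]^n`, the coupling
  operator; `Aop (Rop τ (vec f)) = n^{−n} · T_C(R_τ f)`), `Aadj` its adjoint, `P = projLEX n n d`;
  `Top d = Σ_τ Rop τ⁻¹ ∘ Aadj ∘ P ∘ Aop ∘ Rop τ`, so `⟪Top f, g⟫ = Σ_τ ⟪P A R_τ f, P A R_τ g⟫`:
  `Top` is symmetric, positive, commutes with every `Rop π`, hence preserves every junta space
  `juntaSpace T = {f : f(σ) depends only on σ|_T}` and every `V_{≤d'}` (spanned by juntas).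
* UPPER (`inner_Top_vec_le`): for `(r,γ₁,γ₂,d)`-biglobal `f`, every `R_τ f` is biglobal, `T_C R_τ f` is
  biglobal on `[n]^n` (Lemma 2.7, brick L), so KLM Thm 5.4 (levels `0..d`, brick P) bounds
  `‖P A R_τ f‖² ≤ B/n^n`, `B = 2γ₁²(2200 r² d⁻¹ log(γ₂/γ₁))^d`; summing, `⟪Top f, f⟫ ≤ n!·B/n^n`.
* LOWER (`inner_Top_ge_of_mem_W`): on `W_T = juntaSpace T ⊓ V_{≤d−1}ᗮ` (`|T| = d`),
  `⟪Top w, w⟫ ≥ ‖w‖²/(4^{2d+1} n^n)`: for the `≥ n!/4^d` translates `τ` putting `T` into lazy positions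
  (`card_goodPerm_ge`), `R_τ w` is a pure-degree-`d` junta, and testing `A R_τ w` against the associated
  `[n]^n`-junta `f̃ ∈ V_{≤d}` gives `‖P A R_τ w‖² ≥ ‖w‖²/(4^{d+1} n! n^n)` by Lemma 2.9 (brick C) and
  Cauchy–Schwarz.
* SPECTRAL STEP (`inner_ge_of_invariant_family`, KL: "each eigenvalue `λ` of `T|_{V_d}` satisfies
  `λ ≥ …`"): a symmetric operator bounded below by `c` on each member of a finite family of INVARIANT
  subspaces is bounded below by `c` on their span (eigenspace decomposition of the restrictions); and
  `V_{=d} = levelPart ⊆ Σ_{|T|=d} W_T` (`levelPart_mem_iSup_W`).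
* SANDWICH: `u = f^{=d}`; `Top u ⊥ (f − u)`, so `c‖u‖² ≤ ⟪Top u,u⟫ ≤ ⟪Top f,f⟫ ≤ n! B/n^n`, i.e.
  `‖f^{=d}‖²/n! ≤ 4^{2d+1} B = 8γ₁²(35200 r² d⁻¹ log)^d ≤ γ₁²(10⁶ r² d⁻¹ log)^d`; `d = 0` directly.

No new facts, no instances, no notation; standard axioms. WHAT THIS IS NOT: not a proof of KLM Thm 5.4;
nothing here touches psd rank, matchings, or P-vs-NP.
-/

noncomputable section

namespace Literature.Combinatorics.Additive.KeevashLifshitz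

open Finset ProductSpace Coupling Tuple
open scoped InnerProductSpace

/-! ## Spectral step: invariant subspaces of a symmetric operator -/

section Spectral

variable {E : Type*} [NormedAddCommGroup E] [InnerProductSpace ℝ E]

/-- Eigenvectors of a symmetric operator for distinct eigenvalues are orthogonal. [folklore] -/
private theorem inner_eq_zero_of_mem_eigenspace {T : E →ₗ[ℝ] E} (hT : T.IsSymmetric) {a b : ℝ} (hab : a ≠ b)
    {x y : E} (hx : x ∈ Module.End.eigenspace T a) (hy : y ∈ Module.End.eigenspace T b) :
    ⟪x, y⟫_ℝ = 0 := by
  rw [Module.End.mem_eigenspace_iff] at hx hy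
  have h := hT x y
  rw [hx, hy, real_inner_smul_left, real_inner_smul_right] at h
  have : (a - b) * ⟪x, y⟫_ℝ = 0 := by rw [sub_mul, h, sub_self]
  rcases mul_eq_zero.1 this with h1 | h1
  · exact absurd (sub_eq_zero.1 h1) hab
  · exact h1

/-- On a finite sup of eigenspaces of a symmetric `T` with eigenvalues `≥ c`, `⟪T v, v⟫ ≥ c‖v‖²`.
[cite: KeevashLifshitz2023, §2.3 ("each eigenvalue `λ` of `T` satisfies `λ ≥ …`")] -/
theorem inner_ge_of_mem_iSup_eigenspace {T : E →ₗ[ℝ] E} (hT : T.IsSymmetric) (c : ℝ) (F : Finset ℝ)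
    (hF : ∀ μ ∈ F, c ≤ μ) {v : E} (hv : v ∈ ⨆ μ ∈ F, Module.End.eigenspace T μ) :
    c * ‖v‖ ^ 2 ≤ ⟪T v, v⟫_ℝ := by
  classical
  induction F using Finset.induction_on generalizing v with
  | empty =>
    have : v = 0 := by simpa using hv
    subst this
    simp
  | insert a s ha ih =>
    rw [Finset.iSup_insert, Submodule.mem_sup] at hv
    obtain ⟨x, hx, y, hy, rfl⟩ := hv
    have hTx : T x = a • x := Module.End.mem_eigenspace_iff.1 hx
    have hxy : ⟪x, y⟫_ℝ = 0 := by
      refine Submodule.iSup_induction (fun μ => ⨆ (_ : μ ∈ s), Module.End.eigenspace T μ)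
        (motive := fun z => ⟪x, z⟫_ℝ = 0) hy ?_ (inner_zero_right x)
        (fun z w hz hw => by rw [inner_add_right, hz, hw, add_zero])
      intro μ z hz
      by_cases hμ : μ ∈ s
      · rw [iSup_pos hμ] at hz
        exact inner_eq_zero_of_mem_eigenspace hT (by rintro rfl; exact ha hμ) hx hz
      · rw [iSup_neg hμ, Submodule.mem_bot] at hz
        rw [hz, inner_zero_right]
    have hTxy : ⟪T x, y⟫_ℝ = 0 := by rw [hTx, real_inner_smul_left, hxy, mul_zero]
    have ih' := ih (fun μ hμ => hF μ (Finset.mem_insert_of_mem hμ)) hy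
    have ha' : c ≤ a := hF a (Finset.mem_insert_self a s)
    have e1 : ⟪T (x + y), x + y⟫_ℝ = ⟪T x, x⟫_ℝ + ⟪T y, y⟫_ℝ := by
      have : ⟪T y, x⟫_ℝ = 0 := by rw [hT y x, real_inner_comm (T x) y, hTxy]
      rw [map_add, inner_add_left, inner_add_right, inner_add_right, hTxy, this]
      ring
    have e2 : ‖x + y‖ ^ 2 = ‖x‖ ^ 2 + ‖y‖ ^ 2 := by
      rw [norm_add_sq_real, hxy]; ring
    have e3 : ⟪T x, x⟫_ℝ = a * ‖x‖ ^ 2 := by rw [hTx, real_inner_smul_left, real_inner_self_eq_norm_sq]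
    rw [e1, e2, e3]
    nlinarith [sq_nonneg ‖x‖, ih', ha']

variable [FiniteDimensional ℝ E]

/-- An invariant subspace on which a symmetric `T` is bounded below by `c` lies in a finite sup of
eigenspaces of `T` with eigenvalues `≥ c` (eigen-decomposition of the restriction).
[cite: KeevashLifshitz2023, §2.3] -/
theorem le_iSup_eigenspace_of_invariant {T : E →ₗ[ℝ] E} (hT : T.IsSymmetric) (c : ℝ) (W : Submodule ℝ E)
    (hW : ∀ w ∈ W, T w ∈ W) (hlow : ∀ w ∈ W, c * ‖w‖ ^ 2 ≤ ⟪T w, w⟫_ℝ) :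
    ∃ F : Finset ℝ, (∀ μ ∈ F, c ≤ μ) ∧ W ≤ ⨆ μ ∈ F, Module.End.eigenspace T μ := by
  classical
  have hT' : (T.restrict hW).IsSymmetric := hT.restrict_invariant hW
  let b := hT'.eigenvectorBasis (n := Module.finrank ℝ W) rfl
  let ev := hT'.eigenvalues (n := Module.finrank ℝ W) rfl
  have h1 : ∀ i, T.restrict hW (b i) = ev i • b i := by
    intro i
    have := hT'.apply_eigenvectorBasis rfl i
    simpa only [RCLike.ofReal_real_eq_id, id_eq] using this
  have h1E : ∀ i, T (b i : E) = ev i • (b i : E) := by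
    intro i
    have := congr_arg Subtype.val (h1 i)
    simpa only [LinearMap.coe_restrict_apply, Submodule.coe_smul] using this
  have hnorm : ∀ i, ‖(b i : E)‖ = 1 := fun i => by rw [Submodule.norm_coe]; exact b.orthonormal.1 i
  refine ⟨Finset.univ.image ev, ?_, ?_⟩
  · intro μ hμ
    obtain ⟨i, -, rfl⟩ := Finset.mem_image.1 hμ
    have h2 := hlow (b i : E) (b i).2
    rw [h1E i, real_inner_smul_left, real_inner_self_eq_norm_sq, hnorm i] at h2
    simpa using h2
  · intro w hw
    have hsum := b.sum_repr ⟨w, hw⟩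
    have hsumE : (∑ i, b.repr ⟨w, hw⟩ i • (b i : E)) = w := by
      have := congr_arg Subtype.val hsum
      simpa only [AddSubmonoidClass.coe_finsetSum, Submodule.coe_smul] using this
    rw [← hsumE]
    refine Submodule.sum_mem _ fun i _ => Submodule.smul_mem _ _ ?_
    have hmem : (b i : E) ∈ Module.End.eigenspace T (ev i) := by
      rw [Module.End.mem_eigenspace_iff]; exact h1E i
    exact Submodule.mem_iSup_of_mem (ev i)
      (Submodule.mem_iSup_of_mem (Finset.mem_image_of_mem ev (Finset.mem_univ i)) hmem)

/-- **Spectral step.** A symmetric operator on a finite-dimensional real inner product space that is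
bounded below by `c` on each member of a finite family of invariant subspaces is bounded below by `c` on
their span. [cite: KeevashLifshitz2023, §2.3 ("As `g ∈ V_d(T)`, an invariant space of `R_τ* S* S R_τ` …
we deduce `λ ≥ …`")] -/
theorem inner_ge_of_invariant_family {T : E →ₗ[ℝ] E} (hT : T.IsSymmetric) (c : ℝ) {ι : Type*}
    (s : Finset ι) (W : ι → Submodule ℝ E) (hW : ∀ j ∈ s, ∀ w ∈ W j, T w ∈ W j)
    (hlow : ∀ j ∈ s, ∀ w ∈ W j, c * ‖w‖ ^ 2 ≤ ⟪T w, w⟫_ℝ) {v : E} (hv : v ∈ ⨆ j ∈ s, W j) :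
    c * ‖v‖ ^ 2 ≤ ⟪T v, v⟫_ℝ := by
  classical
  have hch : ∀ j ∈ s, ∃ F : Finset ℝ, (∀ μ ∈ F, c ≤ μ) ∧ W j ≤ ⨆ μ ∈ F, Module.End.eigenspace T μ :=
    fun j hj => le_iSup_eigenspace_of_invariant hT c (W j) (hW j hj) (hlow j hj)
  choose! Fs hFs using hch
  refine inner_ge_of_mem_iSup_eigenspace hT c (s.biUnion Fs) ?_ ?_
  · intro μ hμ
    obtain ⟨j, hj, hμj⟩ := Finset.mem_biUnion.1 hμ
    exact (hFs j hj).1 μ hμj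
  · have hle : (⨆ j ∈ s, W j) ≤ ⨆ μ ∈ s.biUnion Fs, Module.End.eigenspace T μ := by
      refine iSup₂_le fun j hj => (hFs j hj).2.trans ?_
      exact biSup_mono fun μ hμ => Finset.mem_biUnion.2 ⟨j, hj, hμ⟩
    exact hle hv

end Spectral

/-! ## Operators on `L²(S_n)` and `L²([n]^n)` -/

variable {n : ℕ}

/-- `n^n > 0` also for `n = 0`. [folklore] -/
private theorem pow_self_pos' (n : ℕ) : (0 : ℝ) < (n : ℝ) ^ n := by
  rcases Nat.eq_zero_or_pos n with h | h
  · subst h; simp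
  · positivity

/-- Right translation `(R_κ f)(σ) = f(σκ)` as a linear map of `SnSpace n`.
[cite: KeevashLifshitz2023, §2.3 ("`R_τ g = g^τ ∈ L²(S_n)`")] -/
def Rop (κ : Equiv.Perm (Fin n)) : SnSpace n →ₗ[ℝ] SnSpace n where
  toFun f := vec fun σ => f (σ * κ)
  map_add' f g := by ext σ; simp only [vec_apply, PiLp.add_apply]
  map_smul' c f := by ext σ; simp only [vec_apply, PiLp.smul_apply, RingHom.id_apply]

/-- [cite: KeevashLifshitz2023, §2.3] -/
@[simp] theorem Rop_apply (κ : Equiv.Perm (Fin n)) (f : SnSpace n) (σ : Equiv.Perm (Fin n)) :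
    Rop κ f σ = f (σ * κ) := rfl

/-- `R_τ R_π = R_{τπ}`. [cite: KeevashLifshitz2023, §2.3] -/
theorem Rop_mul (τ π : Equiv.Perm (Fin n)) (f : SnSpace n) : Rop τ (Rop π f) = Rop (τ * π) f := by
  ext σ; simp only [Rop_apply, mul_assoc]

/-- [cite: KeevashLifshitz2023, §2.3] -/
theorem Rop_one (f : SnSpace n) : Rop 1 f = f := by
  ext σ; simp only [Rop_apply, mul_one]

/-- `R_κ` is an isometry. [cite: KeevashLifshitz2023, §2.3] -/
theorem inner_Rop (κ : Equiv.Perm (Fin n)) (f g : SnSpace n) : ⟪Rop κ f, Rop κ g⟫_ℝ = ⟪f, g⟫_ℝ := by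
  rw [KeevashLifshitz.inner_eq_sum, KeevashLifshitz.inner_eq_sum]
  simp only [Rop_apply]
  exact Fintype.sum_equiv (Equiv.mulRight κ) _ _ (fun σ => rfl)

/-- The adjoint of `R_κ` is `R_{κ⁻¹}`. [cite: KeevashLifshitz2023, §2.3] -/
theorem inner_Rop_left (κ : Equiv.Perm (Fin n)) (f g : SnSpace n) : ⟪Rop κ f, g⟫_ℝ = ⟪f, Rop κ⁻¹ g⟫_ℝ := by
  have := inner_Rop κ f (Rop κ⁻¹ g)
  rwa [Rop_mul, mul_inv_cancel, Rop_one] at this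

/-- [cite: KeevashLifshitz2023, §2.3] -/
theorem norm_Rop_sq (κ : Equiv.Perm (Fin n)) (f : SnSpace n) : ‖Rop κ f‖ ^ 2 = ‖f‖ ^ 2 := by
  rw [← real_inner_self_eq_norm_sq, ← real_inner_self_eq_norm_sq, inner_Rop]

/-- `R_κ 1_{U_{I→J}} = 1_{U_{κ∘I→J}}`. [cite: KeevashLifshitz2023, Lemma 3.6 (proof)] -/
theorem Rop_indVec_umvirate {t : ℕ} (κ : Equiv.Perm (Fin n)) (I J : Fin t → Fin n) :
    Rop κ (indVec (umvirate I J)) = indVec (umvirate (fun k => κ (I k)) J) := by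
  ext σ
  simp only [Rop_apply, indVec_apply, mem_umvirate, Equiv.Perm.mul_apply]

/-- `R_κ` preserves `V_{≤d'}`. [cite: KeevashLifshitz2023, Lemma 3.6 (proof)] -/
theorem Rop_mem_degLE {d' : ℕ} (κ : Equiv.Perm (Fin n)) {f : SnSpace n} (hf : f ∈ degLE n d') :
    Rop κ f ∈ degLE n d' := by
  refine Submodule.span_induction (p := fun x _ => Rop κ x ∈ degLE n d') ?_ ?_ ?_ ?_ hf
  · rintro v ⟨t, ht, I, J, rfl⟩
    rw [Rop_indVec_umvirate]
    exact indVec_umvirate_mem_degLE ht _ _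
  · rw [map_zero]; exact Submodule.zero_mem _
  · intro x y _ _ hx hy; rw [map_add]; exact Submodule.add_mem _ hx hy
  · intro a x _ hx; rw [map_smul]; exact Submodule.smul_mem _ a hx

/-- `R_κ` commutes with the projections `f ↦ f^{≤d'}`. [cite: KeevashLifshitz2023, §2.3] -/
theorem projLE_Rop (d' : ℕ) (κ : Equiv.Perm (Fin n)) (f : SnSpace n) :
    projLE n d' (Rop κ f) = Rop κ (projLE n d' f) := by
  show (degLE n d').starProjection (Rop κ f) = _
  apply (degLE n d').eq_starProjection_of_mem_of_inner_eq_zero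
  · exact Rop_mem_degLE κ (projLE_mem d' f)
  · intro w hw
    rw [← map_sub, inner_Rop_left]
    exact inner_sub_projLE_eq_zero d' f (Rop_mem_degLE κ⁻¹ hw)

/-- The coupling operator `A f (x) = Σ_σ C(σ,x) f(σ)` (`= n^{−n} · T_C f`).
[cite: KeevashLifshitz2023, §2.1 ("`T_C f(x) = E_{σ∼N(x)} f(σ)`")] -/
def Aop : SnSpace n →ₗ[ℝ] XSpace n n where
  toFun f := vecX fun x => ∑ σ, coupling σ x * f σ
  map_add' f g := by
    ext x; simp only [vecX_apply, PiLp.add_apply, mul_add, sum_add_distrib]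
  map_smul' c f := by
    ext x
    simp only [vecX_apply, PiLp.smul_apply, smul_eq_mul, RingHom.id_apply, mul_sum]
    exact sum_congr rfl fun σ _ => by ring

/-- [cite: KeevashLifshitz2023, §2.1] -/
@[simp] theorem Aop_apply (f : SnSpace n) (x : Fin n → Fin n) : Aop f x = ∑ σ, coupling σ x * f σ := rfl

/-- The adjoint coupling operator `A* u (σ) = Σ_x C(σ,x) u(x)`. [cite: KeevashLifshitz2023, §2.1 ("`E_{x∼N(σ)} g(x)`")] -/
def Aadj : XSpace n n →ₗ[ℝ] SnSpace n where
  toFun u := vec fun σ => ∑ x, coupling σ x * u x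
  map_add' u v := by
    ext σ; simp only [vec_apply, PiLp.add_apply, mul_add, sum_add_distrib]
  map_smul' c u := by
    ext σ
    simp only [vec_apply, PiLp.smul_apply, smul_eq_mul, RingHom.id_apply, mul_sum]
    exact sum_congr rfl fun x _ => by ring

/-- [cite: KeevashLifshitz2023, §2.1] -/
@[simp] theorem Aadj_apply (u : XSpace n n) (σ : Equiv.Perm (Fin n)) : Aadj u σ = ∑ x, coupling σ x * u x := rfl

/-- Adjointness `⟪A* u, g⟫ = ⟪u, A g⟫`. [cite: KeevashLifshitz2023, §2.1] -/
theorem inner_Aadj_left (u : XSpace n n) (g : SnSpace n) : ⟪Aadj u, g⟫_ℝ = ⟪u, Aop g⟫_ℝ := by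
  rw [KeevashLifshitz.inner_eq_sum, ProductSpace.inner_eq_sum]
  simp only [Aadj_apply, Aop_apply, sum_mul, mul_sum]
  rw [sum_comm]
  exact sum_congr rfl fun x _ => sum_congr rfl fun σ _ => by ring

/-- `A (R_τ f) = n^{−n} · T_C(R_τ f)` (the transfer of brick `CouplingBiglobal`). [cite: KeevashLifshitz2023, §2.1] -/
theorem Aop_Rop_vec (τ : Equiv.Perm (Fin n)) (f : Equiv.Perm (Fin n) → ℝ) :
    Aop (Rop τ (vec f)) = ((n : ℝ) ^ n)⁻¹ • vecX (transfer (rshift τ f)) := by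
  ext x
  simp only [Aop_apply, Rop_apply, vec_apply, PiLp.smul_apply, vecX_apply, smul_eq_mul, transfer, rshift]
  rw [← mul_assoc, inv_mul_cancel₀ (pow_self_pos' n).ne', one_mul]

/-- `⟪P u, v⟫ = ⟪P u, P v⟫` for the orthogonal projection `P = projLEX`. [folklore] -/
private theorem inner_projLEX_left_eq (d : ℕ) (u v : XSpace n n) :
    ⟪projLEX n n d u, v⟫_ℝ = ⟪projLEX n n d u, projLEX n n d v⟫_ℝ := by
  have h := inner_sub_projLEX_eq_zero d v (projLEX_mem d u)
  rw [inner_sub_left, sub_eq_zero] at h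
  calc ⟪projLEX n n d u, v⟫_ℝ = ⟪v, projLEX n n d u⟫_ℝ := (real_inner_comm _ _).symm
    _ = ⟪projLEX n n d v, projLEX n n d u⟫_ℝ := h
    _ = ⟪projLEX n n d u, projLEX n n d v⟫_ℝ := (real_inner_comm _ _).symm

/-- `P A R_τ`. [cite: KeevashLifshitz2023, §2.3 ("`S R_τ`")] -/
def PAR (d : ℕ) (τ : Equiv.Perm (Fin n)) : SnSpace n →ₗ[ℝ] XSpace n n :=
  (projLEX n n d).toLinearMap ∘ₗ Aop ∘ₗ Rop τ

/-- [cite: KeevashLifshitz2023, §2.3] -/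
theorem PAR_apply (d : ℕ) (τ : Equiv.Perm (Fin n)) (f : SnSpace n) :
    PAR d τ f = projLEX n n d (Aop (Rop τ f)) := rfl

/-- **The operator `T`** `= Σ_τ R_τ* A* P A R_τ` (the paper's `E_τ R_τ* S* S R_τ`, un-normalised).
[cite: KeevashLifshitz2023, §2.3 ("We consider the operator `T` on `L²(S_n)`")] -/
def Top (d : ℕ) : SnSpace n →ₗ[ℝ] SnSpace n :=
  ∑ τ : Equiv.Perm (Fin n), Rop τ⁻¹ ∘ₗ Aadj ∘ₗ PAR d τ

/-- [cite: KeevashLifshitz2023, §2.3] -/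
theorem Top_apply (d : ℕ) (f : SnSpace n) : Top d f = ∑ τ, Rop τ⁻¹ (Aadj (PAR d τ f)) := by
  simp only [Top, LinearMap.sum_apply, LinearMap.comp_apply]

/-- `⟪T f, g⟫ = Σ_τ ⟪P A R_τ f, P A R_τ g⟫`. [cite: KeevashLifshitz2023, §2.3 ("`⟨Tf, f⟩ = E_τ ‖S R_τ f‖²`")] -/
theorem inner_Top (d : ℕ) (f g : SnSpace n) : ⟪Top d f, g⟫_ℝ = ∑ τ, ⟪PAR d τ f, PAR d τ g⟫_ℝ := by
  rw [Top_apply, sum_inner]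
  refine sum_congr rfl fun τ _ => ?_
  rw [inner_Rop_left, inv_inv, inner_Aadj_left, PAR_apply, PAR_apply]
  exact inner_projLEX_left_eq d _ _

/-- [cite: KeevashLifshitz2023, §2.3] -/
theorem inner_Top_self (d : ℕ) (f : SnSpace n) : ⟪Top d f, f⟫_ℝ = ∑ τ, ‖PAR d τ f‖ ^ 2 := by
  rw [inner_Top]
  exact sum_congr rfl fun τ _ => real_inner_self_eq_norm_sq _

/-- `T` is positive. [cite: KeevashLifshitz2023, §2.3] -/
theorem inner_Top_self_nonneg (d : ℕ) (f : SnSpace n) : 0 ≤ ⟪Top d f, f⟫_ℝ := by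
  rw [inner_Top_self]; exact sum_nonneg fun τ _ => sq_nonneg _

/-- `T` is symmetric. [cite: KeevashLifshitz2023, §2.3] -/
theorem Top_isSymmetric (d : ℕ) : (Top d : SnSpace n →ₗ[ℝ] SnSpace n).IsSymmetric := by
  intro f g
  rw [real_inner_comm (Top d g) f, inner_Top, inner_Top]
  exact sum_congr rfl fun τ _ => real_inner_comm _ _

/-- `T` commutes with right translations. [cite: KeevashLifshitz2023, §2.3 ("an invariant space of `R_τ* S* S R_τ`")] -/
theorem Top_Rop (d : ℕ) (π : Equiv.Perm (Fin n)) (f : SnSpace n) : Top d (Rop π f) = Rop π (Top d f) := by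
  rw [Top_apply, Top_apply, map_sum]
  refine Fintype.sum_equiv (Equiv.mulRight π) _ _ fun τ => ?_
  simp only [Equiv.coe_mulRight, PAR_apply]
  rw [Rop_mul τ π f, Rop_mul π (τ * π)⁻¹, show π * (τ * π)⁻¹ = τ⁻¹ by
    rw [mul_inv_rev, mul_inv_cancel_left]]

/-! ## Junta spaces -/

/-- The `T`-juntas: `f(σ)` depends only on `(σ(i))_{i ∈ T}`. [cite: KeevashLifshitz2023, §1.2 ("`f` is an `I`-junta")] -/
def juntaSpace (Tset : Finset (Fin n)) : Submodule ℝ (SnSpace n) where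
  carrier := {f | ∀ σ σ' : Equiv.Perm (Fin n), (∀ i ∈ Tset, σ i = σ' i) → f σ = f σ'}
  add_mem' := by
    intro f g hf hg σ σ' h
    simp only [PiLp.add_apply, hf σ σ' h, hg σ σ' h]
  zero_mem' := by intro σ σ' _; rfl
  smul_mem' := by
    intro c f hf σ σ' h
    simp only [PiLp.smul_apply, hf σ σ' h]

/-- [cite: KeevashLifshitz2023, §1.2] -/
theorem mem_juntaSpace {Tset : Finset (Fin n)} {f : SnSpace n} :
    f ∈ juntaSpace Tset ↔ ∀ σ σ' : Equiv.Perm (Fin n), (∀ i ∈ Tset, σ i = σ' i) → f σ = f σ' := Iff.rfl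

/-- Juntas are fixed by right translations fixing `T` pointwise. [cite: KeevashLifshitz2023, §1.2] -/
theorem Rop_eq_self_of_mem_juntaSpace {Tset : Finset (Fin n)} {f : SnSpace n} (hf : f ∈ juntaSpace Tset)
    {κ : Equiv.Perm (Fin n)} (hκ : ∀ i ∈ Tset, κ i = i) : Rop κ f = f := by
  ext σ
  rw [Rop_apply]
  exact hf _ _ fun i hi => by rw [Equiv.Perm.mul_apply, hκ i hi]

/-- Conversely, a common fixed vector of these translations is a junta. [cite: KeevashLifshitz2023, §1.2] -/
theorem mem_juntaSpace_of_Rop_eq {Tset : Finset (Fin n)} {f : SnSpace n}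
    (h : ∀ κ : Equiv.Perm (Fin n), (∀ i ∈ Tset, κ i = i) → Rop κ f = f) : f ∈ juntaSpace Tset := by
  intro σ σ' hσ
  have hκ : ∀ i ∈ Tset, (σ⁻¹ * σ') i = i := fun i hi => by
    rw [Equiv.Perm.mul_apply, ← hσ i hi]
    exact σ.symm_apply_apply i
  have := congrArg (fun g : SnSpace n => g σ) (h _ hκ)
  simp only [Rop_apply, mul_inv_cancel_left] at this
  exact this.symm

/-- `T` preserves every junta space. [cite: KeevashLifshitz2023, §2.3 ("an invariant space")] -/
theorem Top_mem_juntaSpace (d : ℕ) {Tset : Finset (Fin n)} {f : SnSpace n} (hf : f ∈ juntaSpace Tset) :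
    Top d f ∈ juntaSpace Tset :=
  mem_juntaSpace_of_Rop_eq fun κ hκ => by rw [← Top_Rop, Rop_eq_self_of_mem_juntaSpace hf hκ]

/-- The projections `f ↦ f^{≤d'}` preserve every junta space. [cite: KeevashLifshitz2023, §2.4 ("`F*`")] -/
theorem projLE_mem_juntaSpace (d' : ℕ) {Tset : Finset (Fin n)} {f : SnSpace n} (hf : f ∈ juntaSpace Tset) :
    projLE n d' f ∈ juntaSpace Tset :=
  mem_juntaSpace_of_Rop_eq fun κ hκ => by rw [← projLE_Rop, Rop_eq_self_of_mem_juntaSpace hf hκ]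

/-- Umvirate indicators are juntas on (any superset of) their index set. [cite: KeevashLifshitz2023, Def. 1.7] -/
theorem indVec_umvirate_mem_juntaSpace {t : ℕ} (I J : Fin t → Fin n) {Tset : Finset (Fin n)}
    (hI : ∀ k, I k ∈ Tset) : indVec (umvirate I J) ∈ juntaSpace Tset := by
  intro σ σ' h
  simp only [indVec_apply, mem_umvirate]
  have hiff : (∀ k, σ (I k) = J k) ↔ (∀ k, σ' (I k) = J k) :=
    forall_congr' fun k => by rw [h (I k) (hI k)]
  by_cases h1 : ∀ k, σ (I k) = J k
  · rw [if_pos h1, if_pos (hiff.1 h1)]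
  · rw [if_neg h1, if_neg (fun h2 => h1 (hiff.2 h2))]

/-- Enumeration of a `d`-set of positions as an embedding `Fin d ↪ Fin n`. [folklore] -/
def enumEmb (Tset : Finset (Fin n)) {d : ℕ} (hT : Tset.card = d) : Fin d ↪ Fin n :=
  ⟨fun k => (Tset.orderIsoOfFin hT k : Fin n),
    fun _ _ h => (Tset.orderIsoOfFin hT).injective (Subtype.ext h)⟩

/-- [folklore] -/
private theorem enumEmb_mem (Tset : Finset (Fin n)) {d : ℕ} (hT : Tset.card = d) (k : Fin d) :
    enumEmb Tset hT k ∈ Tset :=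
  (Tset.orderIsoOfFin hT k).2

/-- [folklore] -/
private theorem exists_enumEmb_eq {Tset : Finset (Fin n)} {d : ℕ} (hT : Tset.card = d) {i : Fin n} (hi : i ∈ Tset) :
    ∃ k, enumEmb Tset hT k = i :=
  ⟨(Tset.orderIsoOfFin hT).symm ⟨i, hi⟩,
    congr_arg Subtype.val ((Tset.orderIsoOfFin hT).apply_symm_apply ⟨i, hi⟩)⟩

/-- **Juntas have degree `≤ |T|`**: a `T`-junta is a combination of the umvirate indicators
`1_{U_{I₀→σ∘I₀}}` (`I₀` enumerating `T`). [cite: KeevashLifshitz2023, Def. 1.7 / §2.3 ("The degree of `R_τ f̃` is at most `d`")] -/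
theorem juntaSpace_le_degLE {Tset : Finset (Fin n)} {d' : ℕ} (hTd : Tset.card ≤ d') :
    juntaSpace Tset ≤ degLE n d' := by
  classical
  intro F hF
  set I₀ := enumEmb Tset rfl
  have hcls : ∀ σ ρ : Equiv.Perm (Fin n),
      ρ ∈ umvirate (fun k => I₀ k) (fun k => σ (I₀ k)) ↔ ∀ i ∈ Tset, ρ i = σ i := by
    intro σ ρ
    rw [mem_umvirate]
    constructor
    · intro h i hi
      obtain ⟨k, rfl⟩ := exists_enumEmb_eq rfl hi
      exact h k
    · intro h k
      exact h _ (enumEmb_mem Tset rfl k)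
  have hrep : F = ∑ σ : Equiv.Perm (Fin n),
      (F σ / ((umvirate (fun k => I₀ k) (fun k => σ (I₀ k))).card : ℝ)) •
        indVec (umvirate (fun k => I₀ k) (fun k => σ (I₀ k))) := by
    ext ρ
    rw [WithLp.ofLp_sum, Finset.sum_apply]
    simp only [WithLp.ofLp_smul, Pi.smul_apply, smul_eq_mul]
    rw [show (∑ σ : Equiv.Perm (Fin n), F σ / ((umvirate (fun k => I₀ k) (fun k => σ (I₀ k))).card : ℝ) *
        (indVec (umvirate (fun k => I₀ k) (fun k => σ (I₀ k)))).ofLp ρ) =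
        ∑ σ : Equiv.Perm (Fin n), if ρ ∈ umvirate (fun k => I₀ k) (fun k => σ (I₀ k)) then
          F σ / ((umvirate (fun k => I₀ k) (fun k => σ (I₀ k))).card : ℝ) else 0 from
      sum_congr rfl fun σ _ => by
        rw [show (indVec (umvirate (fun k => I₀ k) (fun k => σ (I₀ k)))).ofLp ρ =
          if ρ ∈ umvirate (fun k => I₀ k) (fun k => σ (I₀ k)) then 1 else 0 from rfl]
        split_ifs <;> simp]
    rw [← sum_filter]
    have hfilt : (univ : Finset (Equiv.Perm (Fin n))).filter
        (fun σ => ρ ∈ umvirate (fun k => I₀ k) (fun k => σ (I₀ k))) =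
        umvirate (fun k => I₀ k) (fun k => ρ (I₀ k)) := by
      ext σ
      simp only [mem_filter, mem_univ, true_and, hcls]
      constructor <;> intro h i hi <;> exact (h i hi).symm
    rw [hfilt]
    have hconst : ∀ σ ∈ umvirate (fun k => I₀ k) (fun k => ρ (I₀ k)),
        F σ / ((umvirate (fun k => I₀ k) (fun k => σ (I₀ k))).card : ℝ) =
          F ρ / ((umvirate (fun k => I₀ k) (fun k => ρ (I₀ k))).card : ℝ) := by
      intro σ hσ
      rw [hcls] at hσ
      have hU : umvirate (fun k => I₀ k) (fun k => σ (I₀ k)) = umvirate (fun k => I₀ k) (fun k => ρ (I₀ k)) :=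
        congr_arg (umvirate fun k => I₀ k) (funext fun k => hσ _ (enumEmb_mem Tset rfl k))
      rw [hU, hF σ ρ hσ]
    rw [sum_congr rfl hconst, sum_const, nsmul_eq_mul]
    have hpos : (0 : ℝ) < ((umvirate (fun k => I₀ k) (fun k => ρ (I₀ k))).card : ℝ) := by
      exact_mod_cast card_pos.2 ⟨ρ, (hcls ρ ρ).2 fun i _ => rfl⟩
    field_simp
  rw [hrep]
  exact Submodule.sum_mem _ fun σ _ => Submodule.smul_mem _ _ (indVec_umvirate_mem_degLE hTd _ _)

/-- `T` preserves every `V_{≤d'}`. [cite: KeevashLifshitz2023, §2.3] -/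
theorem Top_mem_degLE (d : ℕ) {d' : ℕ} {f : SnSpace n} (hf : f ∈ degLE n d') : Top d f ∈ degLE n d' := by
  classical
  refine Submodule.span_induction (p := fun x _ => Top d x ∈ degLE n d') ?_ ?_ ?_ ?_ hf
  · rintro v ⟨t, ht, I, J, rfl⟩
    have hj : indVec (umvirate I J) ∈ juntaSpace (univ.image I) :=
      indVec_umvirate_mem_juntaSpace I J fun k => mem_image_of_mem I (mem_univ k)
    exact juntaSpace_le_degLE (card_image_le.trans (by rw [card_univ, Fintype.card_fin]; exact ht))
      (Top_mem_juntaSpace d hj)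
  · rw [map_zero]; exact Submodule.zero_mem _
  · intro x y _ _ hx hy; rw [map_add]; exact Submodule.add_mem _ hx hy
  · intro a x _ hx; rw [map_smul]; exact Submodule.smul_mem _ a hx

/-- `V_{≤d'}` is spanned by the `d'`-junta spaces (`d' ≤ n`). [cite: KeevashLifshitz2023, Def. 1.7] -/
theorem degLE_le_iSup_juntaSpace {d' : ℕ} (hd' : d' ≤ n) :
    degLE n d' ≤ ⨆ Tset ∈ (univ : Finset (Fin n)).powersetCard d', juntaSpace Tset := by
  classical
  apply Submodule.span_le.2
  rintro v ⟨t, ht, I, J, rfl⟩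
  obtain ⟨U, hIU, -, hU⟩ := Finset.exists_subsuperset_card_eq (Finset.subset_univ (univ.image I))
    (card_image_le.trans (by rw [card_univ, Fintype.card_fin]; exact ht))
    (show d' ≤ (univ : Finset (Fin n)).card by rw [card_univ, Fintype.card_fin]; exact hd')
  have h : indVec (umvirate I J) ∈ juntaSpace U :=
    indVec_umvirate_mem_juntaSpace I J fun k => hIU (mem_image_of_mem I (mem_univ k))
  exact Submodule.mem_iSup_of_mem U
    (Submodule.mem_iSup_of_mem (mem_powersetCard.2 ⟨subset_univ _, hU⟩) h)

/-- The pure degree-`d` `T`-juntas: `W_T = juntaSpace T ⊓ V_{≤d−1}ᗮ`. [cite: KeevashLifshitz2023, §2.3 ("`g ∈ V_d(T)`")] -/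
def Wsp (d : ℕ) (Tset : Finset (Fin n)) : Submodule ℝ (SnSpace n) := juntaSpace Tset ⊓ (degLE n (d - 1))ᗮ

/-- `W_T` is `T`-invariant. [cite: KeevashLifshitz2023, §2.3] -/
theorem Top_mem_Wsp {d : ℕ} {Tset : Finset (Fin n)} {w : SnSpace n} (hw : w ∈ Wsp d Tset) :
    Top d w ∈ Wsp d Tset := by
  obtain ⟨h1, h2⟩ := Submodule.mem_inf.1 hw
  refine Submodule.mem_inf.2 ⟨Top_mem_juntaSpace d h1, ?_⟩
  rw [Submodule.mem_orthogonal] at h2 ⊢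
  intro u hu
  rw [← Top_isSymmetric d u w]
  exact h2 _ (Top_mem_degLE d hu)

/-- `P_{d−1} ∘ P_d = P_{d−1}`. [cite: KeevashLifshitz2023, Def. 1.7] -/
theorem projLE_pred_projLE {d : ℕ} (hd : 1 ≤ d) (f : SnSpace n) :
    projLE n (d - 1) (projLE n d f) = projLE n (d - 1) f := by
  show (degLE n (d - 1)).starProjection (projLE n d f) = _
  apply (degLE n (d - 1)).eq_starProjection_of_mem_of_inner_eq_zero
  · exact projLE_mem (d - 1) f
  · intro w hw
    have := inner_levelPart_eq_zero hd f hw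
    unfold levelPart at this
    rwa [if_neg (by omega)] at this

/-- **`V_{=d} ⊆ Σ_{|T|=d} W_T`**: `f^{=d}` is a sum of pure degree-`d` `d`-juntas (`1 ≤ d ≤ n`).
[cite: KeevashLifshitz2023, §2.3 ("as `V_d` is spanned by such `g`")] -/
theorem levelPart_mem_iSup_W {d : ℕ} (hd : 1 ≤ d) (hdn : d ≤ n) (f : SnSpace n) :
    levelPart n d f ∈ ⨆ Tset ∈ (univ : Finset (Fin n)).powersetCard d, Wsp d Tset := by
  classical
  have hmem := degLE_le_iSup_juntaSpace hdn (projLE_mem d f)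
  rw [Submodule.mem_iSup_finset_iff_exists_sum] at hmem
  obtain ⟨μ, hμ⟩ := hmem
  have hlp : levelPart n d f = projLE n d f - projLE n (d - 1) (projLE n d f) := by
    unfold levelPart; rw [if_neg (by omega), projLE_pred_projLE hd]
  rw [hlp, ← hμ, map_sum, ← Finset.sum_sub_distrib]
  refine Submodule.sum_mem _ fun T hT => ?_
  refine Submodule.mem_iSup_of_mem T (Submodule.mem_iSup_of_mem hT (Submodule.mem_inf.2 ⟨?_, ?_⟩))
  · exact Submodule.sub_mem _ (μ T).2 (projLE_mem_juntaSpace (d - 1) (μ T).2)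
  · exact (degLE n (d - 1)).sub_starProjection_mem_orthogonal (μ T : SnSpace n)

/-! ## The lower bound on `W_T` -/

/-- **Testing against the associated `[n]^n`-junta** (KL §2.3): for an `ι'`-junta `F` of pure degree `d`
whose positions are lazy (`2·ι'(k) ≤ n`), `‖F‖² ≤ 4^{d+1} n! n^n ‖P A F‖²`.
[cite: KeevashLifshitz2023, §2.3 ("`λ ‖g‖ ‖f̃‖ ≥ ⟨S R_τ g, f̃⟩ ≥ …`")] -/
theorem norm_sq_le_norm_projLEX_Aop_sq {d : ℕ} (hd16 : 16 * d ≤ n) (ι' : Fin d ↪ Fin n)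
    (hι' : ∀ k, 2 * ((ι' k : Fin n) : ℕ) ≤ n) {F : SnSpace n} (hF : IsJunta ι' (fun σ => F σ))
    (horth : ∀ u ∈ degLE n (d - 1), ⟪F, u⟫_ℝ = 0) :
    ‖F‖ ^ 2 ≤ 4 ^ (d + 1) * n.factorial * (n : ℝ) ^ n * ‖projLEX n n d (Aop F)‖ ^ 2 := by
  classical
  have hdn : d ≤ n := by omega
  have hfac : (0 : ℝ) < n.factorial := by positivity
  set g := juntaFun ι' (fun σ => F σ) with hgdef
  have hlift : liftFun ι' g = fun σ => F σ := liftFun_juntaFun hF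
  have hpure : IsPureTop g := by
    refine isPureTop_juntaFun hF fun t ht I J => ?_
    rw [← inner_indVec_left, real_inner_comm]
    exact horth _ (indVec_umvirate_mem_degLE (by omega) I J)
  have key := junta_coupling_lower_bound ι' hι' hd16 hpure
  rw [hlift] at key
  have hS : ∑ σ, F σ ^ 2 = ‖F‖ ^ 2 := (KeevashLifshitz.norm_sq_eq_sum F).symm
  have hrhs : ∑ σ : Equiv.Perm (Fin n), ∑ x : Fin n → Fin n, coupling σ x * (F σ * liftFunX ι' g x) =
      ⟪Aop F, vecX (liftFunX ι' g)⟫_ℝ := by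
    rw [ProductSpace.inner_eq_sum, sum_comm]
    refine sum_congr rfl fun x _ => ?_
    rw [Aop_apply, vecX_apply, sum_mul]
    exact sum_congr rfl fun σ _ => by ring
  have hproj : ⟪Aop F, vecX (liftFunX ι' g)⟫_ℝ = ⟪projLEX n n d (Aop F), vecX (liftFunX ι' g)⟫_ℝ := by
    have := inner_sub_projLEX_eq_zero d (Aop F) (vecX_liftFunX_mem_degLEX ι' g)
    rwa [inner_sub_left, sub_eq_zero] at this
  have hq : ‖vecX (liftFunX ι' g)‖ ^ 2 * n.factorial ≤ (n : ℝ) ^ n * ‖F‖ ^ 2 := by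
    have := norm_liftFunX_sq_le ι' g hdn
    rw [hlift, hS] at this
    rw [ProductSpace.norm_sq_eq_sum]
    simpa only [vecX_apply] using this
  set p := ‖projLEX n n d (Aop F)‖
  set q := ‖vecX (liftFunX ι' g)‖
  have hpq : (1 / 2 : ℝ) ^ (d + 1) * ‖F‖ ^ 2 ≤ n.factorial * (p * q) := by
    have h1 : (1 / 2 : ℝ) ^ (d + 1) * ‖F‖ ^ 2 / n.factorial ≤ p * q := by
      calc (1 / 2 : ℝ) ^ (d + 1) * ‖F‖ ^ 2 / n.factorial
          = (1 / 2 : ℝ) ^ (d + 1) * (∑ σ, F σ ^ 2) / n.factorial := by rw [hS]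
        _ ≤ _ := key
        _ = ⟪projLEX n n d (Aop F), vecX (liftFunX ι' g)⟫_ℝ := by rw [hrhs, hproj]
        _ ≤ p * q := real_inner_le_norm _ _
    rwa [div_le_iff₀ hfac, mul_comm (p * q)] at h1
  by_cases hF0 : ‖F‖ ^ 2 = 0
  · rw [hF0]; positivity
  have hFpos : 0 < ‖F‖ ^ 2 := lt_of_le_of_ne (sq_nonneg _) (Ne.symm hF0)
  have hsq : ((1 / 2 : ℝ) ^ (d + 1) * ‖F‖ ^ 2) ^ 2 ≤ (n.factorial * (p * q)) ^ 2 :=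
    pow_le_pow_left₀ (by positivity) hpq 2
  have h3 : ((n.factorial : ℝ) * (p * q)) ^ 2 ≤ n.factorial * p ^ 2 * ((n : ℝ) ^ n * ‖F‖ ^ 2) := by
    calc ((n.factorial : ℝ) * (p * q)) ^ 2 = n.factorial * p ^ 2 * (q ^ 2 * n.factorial) := by ring
      _ ≤ _ := by gcongr
  have h4 : ((1 / 2 : ℝ) ^ (d + 1)) ^ 2 * ‖F‖ ^ 2 ≤ n.factorial * p ^ 2 * (n : ℝ) ^ n := by
    have := hsq.trans h3
    refine le_of_mul_le_mul_right ?_ hFpos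
    calc ((1 / 2 : ℝ) ^ (d + 1)) ^ 2 * ‖F‖ ^ 2 * ‖F‖ ^ 2 = ((1 / 2 : ℝ) ^ (d + 1) * ‖F‖ ^ 2) ^ 2 := by ring
      _ ≤ _ := this
      _ = n.factorial * p ^ 2 * (n : ℝ) ^ n * ‖F‖ ^ 2 := by ring
  have hA : (4 : ℝ) ^ (d + 1) * ((1 / 2 : ℝ) ^ (d + 1)) ^ 2 = 1 := by
    rw [← pow_mul, mul_comm (d + 1) 2, pow_mul, ← mul_pow]; norm_num
  calc ‖F‖ ^ 2 = 4 ^ (d + 1) * (((1 / 2 : ℝ) ^ (d + 1)) ^ 2 * ‖F‖ ^ 2) := by rw [← mul_assoc, hA, one_mul]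
    _ ≤ 4 ^ (d + 1) * (n.factorial * p ^ 2 * (n : ℝ) ^ n) := by gcongr
    _ = 4 ^ (d + 1) * n.factorial * (n : ℝ) ^ n * p ^ 2 := by ring

/-- **Lower bound on `W_T`** (`|T| = d`, `16 d ≤ n`): `⟪T w, w⟫ ≥ ‖w‖²/(4^{2d+1} n^n)`.
[cite: KeevashLifshitz2023, §2.3 ("`λ ≥ ½ (144)^{−d}`", here with the forgetful coupling's constants)] -/
theorem inner_Top_ge_of_mem_W {d : ℕ} (hd16 : 16 * d ≤ n) {Tset : Finset (Fin n)} (hT : Tset.card = d)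
    {w : SnSpace n} (hw : w ∈ Wsp d Tset) :
    (4 ^ (2 * d + 1) * (n : ℝ) ^ n)⁻¹ * ‖w‖ ^ 2 ≤ ⟪Top d w, w⟫_ℝ := by
  classical
  obtain ⟨hw1, hw2⟩ := Submodule.mem_inf.1 hw
  set ι := enumEmb Tset hT with hιdef
  have hfac : (0 : ℝ) < n.factorial := by positivity
  have hper : ∀ τ ∈ goodPerm ι, ‖w‖ ^ 2 ≤ 4 ^ (d + 1) * n.factorial * (n : ℝ) ^ n * ‖PAR d τ w‖ ^ 2 := by
    intro τ hτ
    rw [mem_goodPerm] at hτ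
    have hι' : ∀ k, 2 * (((ι.trans τ.toEmbedding) k : Fin n) : ℕ) ≤ n := fun k => hτ k
    have hjun : IsJunta (ι.trans τ.toEmbedding) (fun σ => Rop τ w σ) := by
      intro σ σ' h
      simp only [Rop_apply]
      refine hw1 _ _ fun i hi => ?_
      obtain ⟨k, rfl⟩ := exists_enumEmb_eq hT hi
      have := congrArg (fun e : Fin d ↪ Fin n => e k) h
      simp only [restrictPerm_apply, Function.Embedding.trans_apply, Equiv.coe_toEmbedding] at this
      rw [Equiv.Perm.mul_apply, Equiv.Perm.mul_apply]
      exact this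
    have horth : ∀ u ∈ degLE n (d - 1), ⟪Rop τ w, u⟫_ℝ = 0 := fun u hu => by
      rw [inner_Rop_left]
      exact Submodule.inner_left_of_mem_orthogonal (Rop_mem_degLE τ⁻¹ hu) hw2
    have := norm_sq_le_norm_projLEX_Aop_sq hd16 (ι.trans τ.toEmbedding) hι' hjun horth
    rw [norm_Rop_sq] at this
    rw [PAR_apply]
    exact this
  have hsum : ((goodPerm ι).card : ℝ) * ‖w‖ ^ 2 ≤ 4 ^ (d + 1) * n.factorial * (n : ℝ) ^ n * ⟪Top d w, w⟫_ℝ := by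
    rw [inner_Top_self]
    calc ((goodPerm ι).card : ℝ) * ‖w‖ ^ 2 = ∑ τ ∈ goodPerm ι, ‖w‖ ^ 2 := by rw [sum_const, nsmul_eq_mul]
      _ ≤ ∑ τ ∈ goodPerm ι, 4 ^ (d + 1) * n.factorial * (n : ℝ) ^ n * ‖PAR d τ w‖ ^ 2 := sum_le_sum hper
      _ = 4 ^ (d + 1) * n.factorial * (n : ℝ) ^ n * ∑ τ ∈ goodPerm ι, ‖PAR d τ w‖ ^ 2 := by rw [mul_sum]
      _ ≤ 4 ^ (d + 1) * n.factorial * (n : ℝ) ^ n * ∑ τ, ‖PAR d τ w‖ ^ 2 :=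
          mul_le_mul_of_nonneg_left
            (sum_le_sum_of_subset_of_nonneg (subset_univ _) fun τ _ _ => sq_nonneg (‖PAR d τ w‖))
            (by positivity)
  have hgood := card_goodPerm_ge ι hd16
  have h2 : (n.factorial : ℝ) * ‖w‖ ^ 2 ≤
      n.factorial * (4 ^ (2 * d + 1) * (n : ℝ) ^ n * ⟪Top d w, w⟫_ℝ) := by
    calc (n.factorial : ℝ) * ‖w‖ ^ 2 ≤ 4 ^ d * ((goodPerm ι).card : ℝ) * ‖w‖ ^ 2 := by gcongr
      _ = 4 ^ d * (((goodPerm ι).card : ℝ) * ‖w‖ ^ 2) := by ring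
      _ ≤ 4 ^ d * (4 ^ (d + 1) * n.factorial * (n : ℝ) ^ n * ⟪Top d w, w⟫_ℝ) := by gcongr
      _ = n.factorial * (4 ^ (2 * d + 1) * (n : ℝ) ^ n * ⟪Top d w, w⟫_ℝ) := by ring
  rw [inv_mul_le_iff₀ (by have := pow_self_pos' n; positivity)]
  exact le_of_mul_le_mul_left h2 hfac

/-- **Lower bound on `V_{=d}`** (the spectral step applied to the `W_T`): for `1 ≤ d`, `16 d ≤ n`,
`⟪T f^{=d}, f^{=d}⟫ ≥ ‖f^{=d}‖²/(4^{2d+1} n^n)`. [cite: KeevashLifshitz2023, §2.3] -/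
theorem inner_Top_levelPart_ge {d : ℕ} (hd : 1 ≤ d) (hd16 : 16 * d ≤ n) (v : SnSpace n) :
    (4 ^ (2 * d + 1) * (n : ℝ) ^ n)⁻¹ * ‖levelPart n d v‖ ^ 2 ≤
      ⟪Top d (levelPart n d v), levelPart n d v⟫_ℝ := by
  have hdn : d ≤ n := by omega
  exact inner_ge_of_invariant_family (Top_isSymmetric d) _ ((univ : Finset (Fin n)).powersetCard d) (Wsp d)
    (fun T _ w hw => Top_mem_Wsp hw) (fun T hT w hw => inner_Top_ge_of_mem_W hd16 (mem_powersetCard.1 hT).2 hw)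
    (levelPart_mem_iSup_W hd hdn v)

/-! ## The upper bound and the sandwich -/

/-- **Upper bound** (Lemma 2.7 + KLM Thm 5.4 per translate): for `(r,γ₁,γ₂,d)`-biglobal `f`,
`⟪T f, f⟫ ≤ n! · 2γ₁²(2200 r² d⁻¹ log(γ₂/γ₁))^d / n^n`.
[cite: KeevashLifshitz2023, Lemma 3.6 (proof)] [cite: KellerLifshitzMarcus2023, Thm. 5.4] -/
theorem inner_Top_vec_le (hKLM : KellerLifshitzMarcus2023_thm54) {f : Equiv.Perm (Fin n) → ℝ}
    {r γ₁ γ₂ : ℝ} {d : ℕ} (hr : 1 < r) (hγ₁ : 0 < γ₁) (hγ : γ₁ < γ₂)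
    (hd : (d : ℝ) ≤ Real.log (γ₂ / γ₁) / 2) (hf : IsBiglobal r γ₁ γ₂ d f) :
    ⟪Top d (vec f), vec f⟫_ℝ ≤
      n.factorial * (2 * γ₁ ^ 2 * (2200 * r ^ 2 * (1 / (d : ℝ)) * Real.log (γ₂ / γ₁)) ^ d) / (n : ℝ) ^ n := by
  have hnn := pow_self_pos' n
  set B := 2 * γ₁ ^ 2 * (2200 * r ^ 2 * (1 / (d : ℝ)) * Real.log (γ₂ / γ₁)) ^ d
  have hper : ∀ τ : Equiv.Perm (Fin n), ‖PAR d τ (vec f)‖ ^ 2 ≤ B / (n : ℝ) ^ n := by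
    intro τ
    have hh : IsBiglobalX r γ₁ γ₂ d (transfer (rshift τ f)) :=
      isBiglobalX_transfer hr.le hγ₁.le (isBiglobal_rshift hf τ)
    have hk := norm_projLEX_sq_le hKLM hr hγ₁ hγ hd hh
    rw [div_le_iff₀ hnn] at hk
    rw [PAR_apply, Aop_Rop_vec, map_smul, norm_smul, mul_pow, Real.norm_eq_abs, abs_inv,
      abs_of_pos hnn, le_div_iff₀ hnn]
    calc ((n : ℝ) ^ n)⁻¹ ^ 2 * ‖projLEX n n d (vecX (transfer (rshift τ f)))‖ ^ 2 * (n : ℝ) ^ n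
        = ((n : ℝ) ^ n)⁻¹ * ‖projLEX n n d (vecX (transfer (rshift τ f)))‖ ^ 2 := by field_simp
      _ ≤ ((n : ℝ) ^ n)⁻¹ * (B * (n : ℝ) ^ n) := mul_le_mul_of_nonneg_left hk (by positivity)
      _ = B := by field_simp
  rw [inner_Top_self]
  calc ∑ τ : Equiv.Perm (Fin n), ‖PAR d τ (vec f)‖ ^ 2 ≤ ∑ τ : Equiv.Perm (Fin n), B / (n : ℝ) ^ n :=
        sum_le_sum fun τ _ => hper τ
    _ = n.factorial * B / (n : ℝ) ^ n := by
        rw [sum_const, card_univ, Fintype.card_perm, Fintype.card_fin, nsmul_eq_mul]; ring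

/-- **Sandwich**: `⟪T u, u⟫ ≤ ⟪T (u + w), u + w⟫` when `T u ⊥ w` (positivity of `T`). [cite: KeevashLifshitz2023, §2.3] -/
theorem inner_Top_le_of_orthogonal (d : ℕ) {u w : SnSpace n} (h : ⟪Top d u, w⟫_ℝ = 0) :
    ⟪Top d u, u⟫_ℝ ≤ ⟪Top d (u + w), u + w⟫_ℝ := by
  have h' : ⟪Top d w, u⟫_ℝ = 0 := by rw [Top_isSymmetric d w u, real_inner_comm (Top d u) w, h]
  calc ⟪Top d u, u⟫_ℝ ≤ ⟪Top d u, u⟫_ℝ + ⟪Top d w, w⟫_ℝ := le_add_of_nonneg_right (inner_Top_self_nonneg d w)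
    _ = ⟪Top d (u + w), u + w⟫_ℝ := by
        rw [map_add, inner_add_left, inner_add_right, inner_add_right, h, h']; ring

/-- `T f^{=d} ⊥ f − f^{=d}` (`d ≥ 1`). [cite: KeevashLifshitz2023, §2.3] -/
theorem inner_Top_levelPart_sub_eq_zero {d : ℕ} (hd : 1 ≤ d) (v : SnSpace n) :
    ⟪Top d (levelPart n d v), v - levelPart n d v⟫_ℝ = 0 := by
  have hTu1 : Top d (levelPart n d v) ∈ degLE n d := Top_mem_degLE d (levelPart_mem d v)
  have hTu2 : ∀ z ∈ degLE n (d - 1), ⟪Top d (levelPart n d v), z⟫_ℝ = 0 := fun z hz => by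
    rw [Top_isSymmetric d _ z]
    exact inner_levelPart_eq_zero hd v (Top_mem_degLE d hz)
  have hw : v - levelPart n d v = (v - projLE n d v) + projLE n (d - 1) v := by
    unfold levelPart; rw [if_neg (by omega)]; abel
  rw [hw, inner_add_right, real_inner_comm (v - projLE n d v), inner_sub_projLE_eq_zero d v hTu1,
    hTu2 _ (projLE_mem (d - 1) v), zero_add]

/-- The `d = 0` part: `f^{≤0} = (Σ f / n!) · 1`. [cite: KeevashLifshitz2023, Def. 1.7] -/
theorem projLE_zero_vec (f : Equiv.Perm (Fin n) → ℝ) :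
    projLE n 0 (vec f) = ((∑ σ, f σ) / n.factorial) • indVec (univ : Finset (Equiv.Perm (Fin n))) := by
  have hV : degLE n 0 ≤ Submodule.span ℝ {indVec (univ : Finset (Equiv.Perm (Fin n)))} := by
    apply Submodule.span_le.2
    rintro v ⟨t, ht, I, J, rfl⟩
    obtain rfl : t = 0 := by omega
    rw [umvirate_fin_zero]
    exact Submodule.subset_span rfl
  show (degLE n 0).starProjection (vec f) = _
  apply (degLE n 0).eq_starProjection_of_mem_of_inner_eq_zero
  · exact Submodule.smul_mem _ _ (indVec_univ_mem_degLE 0)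
  · intro w hw
    have hw' := hV hw
    rw [Submodule.mem_span_singleton] at hw'
    obtain ⟨a, rfl⟩ := hw'
    rw [inner_smul_right, inner_sub_left, inner_smul_left, real_inner_comm, inner_indVec_left,
      inner_indVec_left]
    simp only [vec_apply, indVec_apply, mem_univ, if_true, sum_const, card_univ, Fintype.card_perm,
      Fintype.card_fin, nsmul_eq_mul, mul_one, RCLike.conj_to_real]
    have hf : (n.factorial : ℝ) ≠ 0 := by positivity
    field_simp
    ring

/-- `8 · 35200^d ≤ 10^{6d}` for `d ≥ 1`. [folklore] -/
private theorem const_ineq {d : ℕ} (hd : 1 ≤ d) : (8 : ℝ) * 35200 ^ d ≤ (10 ^ 6) ^ d := by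
  obtain ⟨d', rfl⟩ : ∃ d', d = d' + 1 := ⟨d - 1, by omega⟩
  rw [pow_succ, pow_succ]
  have h1 : (35200 : ℝ) ^ d' ≤ (10 ^ 6) ^ d' := pow_le_pow_left₀ (by norm_num) (by norm_num) d'
  nlinarith [h1, pow_nonneg (show (0 : ℝ) ≤ 35200 by norm_num) d']

/-- **Keevash–Lifshitz Theorem 3.1 (`S_n`, biglobal form) from Keller–Lifshitz–Marcus Theorem 5.4.**
The tree's named fact `GlobalLevelDInequalityBiglobal` — for `(r, γ₁, γ₂, d)`-biglobal `f` on `S_n` with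
`r > 1`, `0 < γ₁ < γ₂`, `d ≤ ¼ log(γ₂/γ₁)`, `d ≤ 10⁻⁵ n`: `‖f^{=d}‖²/n! ≤ γ₁² (10⁶ r² d⁻¹ log(γ₂/γ₁))^d` —
holds assuming only KLM Thm 5.4 for the uniform product spaces `[n]^n`.
[cite: KeevashLifshitz2023, Thm. 3.1, Lemma 3.6, §2.3] [cite: KellerLifshitzMarcus2023, Thm. 5.4] -/
theorem GlobalLevelDInequalityBiglobal_of_klm (hKLM : KellerLifshitzMarcus2023_thm54) :
    GlobalLevelDInequalityBiglobal := by
  intro n f r γ₁ γ₂ d hr hγ₁ hγ hf hdlog hdn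
  have hlogpos : 0 < Real.log (γ₂ / γ₁) := Real.log_pos ((one_lt_div hγ₁).2 hγ)
  have hfac : (0 : ℝ) < n.factorial := by positivity
  rcases Nat.eq_zero_or_pos d with hd0 | hdpos
  · -- `d = 0`: `f^{=0} = (Σ f/n!)·1` and `|Σ f| ≤ γ₁ n!` by biglobalness at `t = 0`
    subst hd0
    have hlp : levelPart n 0 (vec f) = ((∑ σ, f σ) / n.factorial) • indVec (univ : Finset (Equiv.Perm (Fin n))) := by
      unfold levelPart; rw [if_pos rfl, projLE_zero_vec]
    have h0 := (hf 0 le_rfl Fin.elim0 Fin.elim0 (Function.injective_of_subsingleton _)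
      (Function.injective_of_subsingleton _)).1
    rw [umvirate_fin_zero, pow_zero, one_mul, card_univ, Fintype.card_perm, Fintype.card_fin] at h0
    have habs : |∑ σ, f σ| ≤ γ₁ * n.factorial := (abs_sum_le_sum_abs _ _).trans h0
    rw [hlp, norm_smul, mul_pow, Real.norm_eq_abs, sq_abs, norm_indVec_sq, card_univ, Fintype.card_perm,
      Fintype.card_fin, pow_zero, mul_one]
    rw [show ((∑ σ, f σ) / n.factorial) ^ 2 * (n.factorial : ℝ) / n.factorial = ((∑ σ, f σ) / n.factorial) ^ 2 by
      field_simp]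
    rw [div_pow, div_le_iff₀ (by positivity)]
    calc (∑ σ, f σ) ^ 2 = |∑ σ, f σ| ^ 2 := (sq_abs _).symm
      _ ≤ (γ₁ * n.factorial) ^ 2 := pow_le_pow_left₀ (abs_nonneg _) habs 2
      _ = γ₁ ^ 2 * (n.factorial : ℝ) ^ 2 := by ring
  · -- `d ≥ 1`
    have hd1 : 1 ≤ d := hdpos
    have hd16 : 16 * d ≤ n := by
      have h1 : (d : ℝ) * 10 ^ 5 ≤ n := by rwa [le_div_iff₀ (by positivity)] at hdn
      have : ((16 * d : ℕ) : ℝ) ≤ n := by push_cast; nlinarith [Nat.cast_nonneg (α := ℝ) d]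
      exact_mod_cast this
    have hd2 : (d : ℝ) ≤ Real.log (γ₂ / γ₁) / 2 := by linarith
    set u := levelPart n d (vec f) with hudef
    set L := Real.log (γ₂ / γ₁) with hL
    set X := r ^ 2 * (1 / (d : ℝ)) * L with hX
    have hX0 : 0 ≤ X := by positivity
    set B := 2 * γ₁ ^ 2 * (2200 * r ^ 2 * (1 / (d : ℝ)) * L) ^ d with hB
    -- the sandwich
    have hup : ⟪Top d (vec f), vec f⟫_ℝ ≤ n.factorial * B / (n : ℝ) ^ n := inner_Top_vec_le hKLM hr hγ₁ hγ hd2 hf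
    have hmid : ⟪Top d u, u⟫_ℝ ≤ ⟪Top d (vec f), vec f⟫_ℝ := by
      have := inner_Top_le_of_orthogonal d (inner_Top_levelPart_sub_eq_zero hd1 (vec f))
      rwa [add_sub_cancel] at this
    have hlow : (4 ^ (2 * d + 1) * (n : ℝ) ^ n)⁻¹ * ‖u‖ ^ 2 ≤ ⟪Top d u, u⟫_ℝ :=
      inner_Top_levelPart_ge hd1 hd16 (vec f)
    have hnn := pow_self_pos' n
    have hchain : (4 ^ (2 * d + 1) * (n : ℝ) ^ n)⁻¹ * ‖u‖ ^ 2 ≤ n.factorial * B / (n : ℝ) ^ n :=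
      hlow.trans (hmid.trans hup)
    rw [inv_mul_le_iff₀ (by positivity)] at hchain
    -- `‖u‖² ≤ 4^{2d+1} n! B`
    have hu : ‖u‖ ^ 2 / n.factorial ≤ 4 ^ (2 * d + 1) * B := by
      rw [div_le_iff₀ hfac]
      calc ‖u‖ ^ 2 ≤ 4 ^ (2 * d + 1) * (n : ℝ) ^ n * (n.factorial * B / (n : ℝ) ^ n) := hchain
        _ = 4 ^ (2 * d + 1) * B * n.factorial := by field_simp
    -- constants: `4^{2d+1} B = 8 γ₁² (35200 X)^d ≤ γ₁² (10⁶ X)^d`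
    have hkey : (4 : ℝ) ^ (2 * d + 1) * B ≤ γ₁ ^ 2 * (10 ^ 6 * X) ^ d := by
      have h8 : (4 : ℝ) ^ (2 * d + 1) * 2 * 2200 ^ d = 8 * 35200 ^ d := by
        rw [pow_succ, pow_mul, show (35200 : ℝ) = 4 ^ 2 * 2200 by norm_num, mul_pow]; ring
      calc (4 : ℝ) ^ (2 * d + 1) * B = γ₁ ^ 2 * X ^ d * ((4 : ℝ) ^ (2 * d + 1) * 2 * 2200 ^ d) := by
            rw [hB, hX, mul_pow, mul_pow, mul_pow, mul_pow]; ring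
        _ = γ₁ ^ 2 * X ^ d * (8 * 35200 ^ d) := by rw [h8]
        _ ≤ γ₁ ^ 2 * X ^ d * (10 ^ 6) ^ d := by gcongr; exact const_ineq hd1
        _ = γ₁ ^ 2 * (10 ^ 6 * X) ^ d := by rw [mul_pow]; ring
    calc ‖u‖ ^ 2 / n.factorial ≤ 4 ^ (2 * d + 1) * B := hu
      _ ≤ γ₁ ^ 2 * (10 ^ 6 * X) ^ d := hkey
      _ = γ₁ ^ 2 * (10 ^ 6 * r ^ 2 * (1 / (d : ℝ)) * L) ^ d := by rw [hX]; ring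

/-- **Keevash–Lifshitz Theorem 1.8 from Keller–Lifshitz–Marcus Theorem 5.4**: the tree's named fact
`GlobalLevelDInequality` (level-`d` inequality for `r`-global sets in `S_n`, constant `10⁶`, exponent
`r⁴`) follows, via the tree's `GlobalLevelDInequality_of_biglobal`.
[cite: KeevashLifshitz2023, Thm. 1.8] [cite: KellerLifshitzMarcus2023, Thm. 5.4] -/
theorem GlobalLevelDInequality_of_klm (hKLM : KellerLifshitzMarcus2023_thm54) : GlobalLevelDInequality :=
  GlobalLevelDInequality_of_biglobal (GlobalLevelDInequalityBiglobal_of_klm hKLM)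

/-- **Keevash–Lifshitz Theorem 3.1 (`S_n`, biglobal form) holds**: the tree's named fact
`GlobalLevelDInequalityBiglobal` (constant `10⁶`), by `GlobalLevelDInequalityBiglobal_of_klm` and the now
proved KLM Thm 5.4 on `[m]^N` (`ProductSpace.KellerLifshitzMarcus2023_thm54_holds`,
`ProductSpaceHypercontractivity.lean`). [cite: KeevashLifshitz2023, Thm. 3.1] [cite: KellerLifshitzMarcus2023, Thm. 5.4] -/
theorem GlobalLevelDInequalityBiglobal_holds : GlobalLevelDInequalityBiglobal :=
  GlobalLevelDInequalityBiglobal_of_klm KellerLifshitzMarcus2023_thm54_holds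

/-- **Keevash–Lifshitz Theorem 1.8 holds**: the tree's named fact `GlobalLevelDInequality` (level-`d`
inequality for `r`-global subsets of `S_n`, constant `10⁶`), by `GlobalLevelDInequality_of_klm` and
`ProductSpace.KellerLifshitzMarcus2023_thm54_holds`. [cite: KeevashLifshitz2023, Thm. 1.8] [cite: KellerLifshitzMarcus2023, Thm. 5.4] -/
theorem GlobalLevelDInequality_holds : GlobalLevelDInequality :=
  GlobalLevelDInequality_of_klm KellerLifshitzMarcus2023_thm54_holds

end Literature.Combinatorics.Additive.KeevashLifshitz

end
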